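import Mathlib
import HarnessLib
import Summits.HubbardSuperconductivity.HubbardSuperconductivity.Theorems.KLProgrammeKLRegimeSplitPhRotationPlanar

/-!
# Route `KLProgramme` — ENGINE (stmt-HubbardSuperconductivity-20437 `KLRegimeEngineV17F2`), row (c) binder #8 (★ v19 `hexLadMV`, value rows `RP RQ`), brick O6i-a:
# THE PARTICLE–HOLE ROTATION LEMMA WITH AN ANGULAR WEIGHT, PLANAR FORM — the rotation null holds PER FERMI-SURFACE ANGLE: a weight `w` that is constant along the
# radial (level) direction of the C4a chart (`w(levelChart(ρ,ϑ)) = v(ϑ)`) factors through the `v`-weighted level density `N_v(ρ) = ∫J(ρ,ϑ)v(ϑ)dϑ`, and the bound is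
# `B_v ×` (O6a's thermal + DOS-slope sizes)
# (cell gate-hubbard-kl, seat hubbard-kl-k3c2-p2 g32, technique «thermal-bar induction n ≤ nScales β + 1 with EngineBoundsAtV4S sums»)

WHY.  O6a (`klph_planar_rotation_le`) treats the zero-transfer one-slice p-h bubble against a CONSTANT frozen kernel product; by value the kernels' product varies by
`O(c₄U·U²N0·log)` ACROSS the Fermi-surface angle `ϑ` (Cooper corner vs generic angle), so a `ϑ`-uniform frozen value leaves an n-flat U³ moduli charge (this seat's CAVEAT, KL STATUS
≈05:15Z; = p1 g28's «adversarial flat c_V» reading).  The cure is to freeze the product RADIALLY at each angle: `V₀ = V₀(ϑ)`.  The rotation null survives because the swap antisymmetry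
`∫∫ f dω de = 0` acts in the `(ω, e)` plane at FIXED `ϑ`; only the level density acquires the weight: `N_v(ρ) = ∫_{(0,2π]} J(ρ,ϑ)·v(ϑ) dϑ`, with `|N_v(ρ)| ≤ B_v·N₀max` and
`|N_v(ρ) − N_v(0)| ≤ B_v·2π·jacR·|ρ|` from the POINTWISE chart Lipschitz row `abs_levelChartJac_sub_le` (c4a).

* §1 `klpw_*` — the `v`-weighted level density: integrable angular section, bound, Lipschitz in `ρ`, continuity.
* §2 `klpw_integral_tube_weighted_eq` — `∫_{tube} w(q)·φ(e_K(q)) dq = ∫_{(−r,r)} N_v(ρ)·φ(ρ) dρ` for `w(levelChart(ρ,ϑ)) = v(ϑ)` (`v` measurable, bounded, `2π`-periodic).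
* §3 **`klpw_planar_rotation_weighted_le`** — under O6a's hypotheses plus the weight data:
  `|β⁻¹ Σ_i ∫_{tube} w(q)·G(ω_i² + e_K²)(e_K² − ω_i²)/(ω_i² + e_K²)² dq| ≤ B_v·[N₀max·(2r₂(2r₂L⋆))(r₂ + 2π/β)/β + β⁻¹(r₂β/π + 1)(2r₂)(2π·jacR·r₂·M_G/r₁²)]`.
Pure analysis on the tree's objects; no definitions; nothing asserts (c), K3 or superconductivity.  [cite: BenfattoGiulianiMastropietro2006, §2.4–§2.5]
-/

noncomputable section

namespace Summit.HubbardSuperconductivity.HubbardSuperconductivity.Theorems.KLRegimeSplit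

set_option linter.dupNamespace false -- summit = problem name (single-conjunct summit), D-0017

open Real Set Finset MeasureTheory Literature.MathematicalPhysics.QuantumLattice Literature.Probability.LatticeModels
open Literature.MathematicalPhysics.QuantumLattice.BandSectorCounting
open Summit.HubbardSuperconductivity.HubbardSuperconductivity.Theorems.TwoPointAssembly
open Summit.HubbardSuperconductivity.HubbardSuperconductivity.Theorems.EngineV8
open Summit.HubbardSuperconductivity.HubbardSuperconductivity.Theorems.DispersionFlow
open Summit.HubbardSuperconductivity.HubbardSuperconductivity.Theorems.PerturbedFermiCurve
open Summit.HubbardSuperconductivity.HubbardSuperconductivity.Theorems.C4a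

section Chart

variable {a b : ℝ} (B : BandBounds a b) {K : TrigPolyC4v} {A : ℝ}
  (hA : ∀ p : Momentum, ∀ j ≤ 2, ‖iteratedFDeriv ℝ j (frameShift K) p‖ ≤ A) (hADt : 2 * A < B.Dtmin)
  {μ r : ℝ} (hlo : a < μ - r - A) (hhi : μ + r + A < b)
include B hA hADt hlo hhi

/-! ## §1 The `v`-weighted level density `N_v(ρ) = ∫_{(0,2π]} J(ρ,ϑ)·v(ϑ) dϑ` -/

/-- The weighted angular section is integrable on `(0, 2π]` (`v` measurable and bounded). -/
theorem klpw_integrableOn_jac_mul {v : ℝ → ℝ} (hvm : Measurable v) {Bv : ℝ} (hvb : ∀ ϑ, |v ϑ| ≤ Bv) {ρ : ℝ} (hρ : ρ ∈ Ioo (-r) r) :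
    IntegrableOn (fun ϑ : ℝ => levelChartJac μ K (ρ, ϑ) * v ϑ) (Ioc 0 (2 * π)) := by
  refine Integrable.mul_of_top_left (integrableOn_levelChartJac_angle B hA hADt hlo hhi hρ) ?_
  exact memLp_top_of_bound hvm.aestronglyMeasurable Bv (Filter.Eventually.of_forall fun ϑ => by rw [Real.norm_eq_abs]; exact hvb ϑ)

/-- `|N_v(ρ)| ≤ B_v·2π·(π√2/(Dt_min − 2A))`. -/
theorem klpw_abs_weightedDensity_le {v : ℝ → ℝ} {Bv : ℝ} (hvb : ∀ ϑ, |v ϑ| ≤ Bv) {ρ : ℝ} (hρ : ρ ∈ Ioo (-r) r) :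
    |∫ ϑ in Ioc 0 (2 * π), levelChartJac μ K (ρ, ϑ) * v ϑ| ≤ Bv * (2 * π * (π * Real.sqrt 2 / (B.Dtmin - 2 * A))) := by
  have hπ := Real.pi_pos
  have hBv : 0 ≤ Bv := (abs_nonneg _).trans (hvb 0)
  have hvol : volume (Ioc 0 (2 * π)) < ⊤ := by rw [Real.volume_Ioc]; exact ENNReal.ofReal_lt_top
  have hd : 0 < B.Dtmin - 2 * A := by linarith
  have hK0 : 0 ≤ π * Real.sqrt 2 / (B.Dtmin - 2 * A) := by positivity
  have h := norm_setIntegral_le_of_norm_le_const hvol (f := fun ϑ => levelChartJac μ K (ρ, ϑ) * v ϑ)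
    (C := π * Real.sqrt 2 / (B.Dtmin - 2 * A) * Bv) (fun ϑ _ => by
      have h' := levelChartJac_nonneg_le B hA hADt hlo hhi (p := (ρ, ϑ)) hρ
      rw [Real.norm_eq_abs, abs_mul, abs_of_nonneg h'.1]
      exact mul_le_mul h'.2 (hvb ϑ) (abs_nonneg _) hK0)
  rw [Real.norm_eq_abs, Real.volume_real_Ioc_of_le (by positivity), sub_zero] at h
  calc _ ≤ π * Real.sqrt 2 / (B.Dtmin - 2 * A) * Bv * (2 * π) := h
    _ = Bv * (2 * π * (π * Real.sqrt 2 / (B.Dtmin - 2 * A))) := by ring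

/-- **The weighted level density is Lipschitz**: `|N_v(ρ) − N_v(ρ′)| ≤ B_v·2π·jacR·|ρ − ρ′|`. -/
theorem klpw_abs_weightedDensity_sub_le {v : ℝ → ℝ} (hvm : Measurable v) {Bv : ℝ} (hvb : ∀ ϑ, |v ϑ| ≤ Bv) {ρ ρ' : ℝ} (hρ : ρ ∈ Ioo (-r) r)
    (hρ' : ρ' ∈ Ioo (-r) r) :
    |(∫ ϑ in Ioc 0 (2 * π), levelChartJac μ K (ρ, ϑ) * v ϑ) - ∫ ϑ in Ioc 0 (2 * π), levelChartJac μ K (ρ', ϑ) * v ϑ| ≤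
      Bv * (2 * π * ((1 / (B.Dtmin - 2 * A) ^ 2 + Real.pi * Real.sqrt 2 * (2 + 4 * A) / (B.Dtmin - 2 * A) ^ 3) * |ρ - ρ'|)) := by
  have hπ := Real.pi_pos
  have hBv : 0 ≤ Bv := (abs_nonneg _).trans (hvb 0)
  have hA0 : 0 ≤ A := le_trans (norm_nonneg _) (hA 0 0 (by norm_num))
  have hjac := (jacRadialConst_pos B hADt hA0).le
  rw [← integral_sub (klpw_integrableOn_jac_mul B hA hADt hlo hhi hvm hvb hρ) (klpw_integrableOn_jac_mul B hA hADt hlo hhi hvm hvb hρ')]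
  have hvol : volume (Ioc 0 (2 * π)) < ⊤ := by rw [Real.volume_Ioc]; exact ENNReal.ofReal_lt_top
  have h := norm_setIntegral_le_of_norm_le_const hvol (f := fun ϑ => levelChartJac μ K (ρ, ϑ) * v ϑ - levelChartJac μ K (ρ', ϑ) * v ϑ)
    (C := (1 / (B.Dtmin - 2 * A) ^ 2 + Real.pi * Real.sqrt 2 * (2 + 4 * A) / (B.Dtmin - 2 * A) ^ 3) * |ρ - ρ'| * Bv)
    (fun ϑ _ => by
      rw [Real.norm_eq_abs, ← sub_mul, abs_mul]
      exact mul_le_mul (abs_levelChartJac_sub_le B hA hADt hlo hhi hρ hρ' ϑ) (hvb ϑ) (abs_nonneg _) (by positivity))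
  rw [Real.norm_eq_abs, Real.volume_real_Ioc_of_le (by positivity), sub_zero] at h
  calc _ ≤ (1 / (B.Dtmin - 2 * A) ^ 2 + Real.pi * Real.sqrt 2 * (2 + 4 * A) / (B.Dtmin - 2 * A) ^ 3) * |ρ - ρ'| * Bv * (2 * π) := h
    _ = _ := by ring

/-- The weighted level density is continuous on `(−r, r)` (Lipschitz there). -/
theorem klpw_continuousOn_weightedDensity {v : ℝ → ℝ} (hvm : Measurable v) {Bv : ℝ} (hvb : ∀ ϑ, |v ϑ| ≤ Bv) :
    ContinuousOn (fun ρ => ∫ ϑ in Ioc 0 (2 * π), levelChartJac μ K (ρ, ϑ) * v ϑ) (Ioo (-r) r) := by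
  set C := Bv * (2 * π * (1 / (B.Dtmin - 2 * A) ^ 2 + Real.pi * Real.sqrt 2 * (2 + 4 * A) / (B.Dtmin - 2 * A) ^ 3)) with hC
  have hlip : ∀ ρ ∈ Ioo (-r) r, ∀ ρ' ∈ Ioo (-r) r,
      dist (∫ ϑ in Ioc 0 (2 * π), levelChartJac μ K (ρ, ϑ) * v ϑ) (∫ ϑ in Ioc 0 (2 * π), levelChartJac μ K (ρ', ϑ) * v ϑ) ≤ |C| * dist ρ ρ' := by
    intro ρ hρ ρ' hρ'
    rw [Real.dist_eq, Real.dist_eq]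
    have h := klpw_abs_weightedDensity_sub_le B hA hADt hlo hhi hvm hvb hρ hρ'
    calc _ ≤ C * |ρ - ρ'| := by rw [hC]; linarith
      _ ≤ |C| * |ρ - ρ'| := mul_le_mul_of_nonneg_right (le_abs_self C) (abs_nonneg _)
  exact (LipschitzOnWith.of_dist_le_mul (K := ⟨|C|, abs_nonneg C⟩) fun ρ hρ ρ' hρ' => hlip ρ hρ ρ' hρ').continuousOn

/-! ## §2 Angularly weighted level functions over the tube in chart coordinates -/

/-- **An angularly weighted, bounded measurable function of the level, integrated over the tube, in level coordinates**: if the planar weight `w` is radially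
constant in the chart, `w(levelChart(ρ,ϑ)) = v(ϑ)` (`v` measurable, bounded, `2π`-periodic), then
`∫_{|q₁|,|q₂| < π, |e_K(q)| < r} w(q)·φ(e_K(q)) dq = ∫_{ρ ∈ (−r,r)} N_v(ρ)·φ(ρ) dρ`, `N_v(ρ) = ∫_{(0,2π]} J(ρ,ϑ)·v(ϑ) dϑ`.
[cite: BenfattoGiulianiMastropietro2006, §2.4 (2.40)] -/
theorem klpw_integral_tube_weighted_eq (φ : ℝ → ℝ) (hφm : Measurable φ) {C : ℝ} (hφb : ∀ x, |φ x| ≤ C)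
    (w : ℝ × ℝ → ℝ) (v : ℝ → ℝ) (hvm : Measurable v) (hvp : Function.Periodic v (2 * π)) {Bv : ℝ} (hvb : ∀ ϑ, |v ϑ| ≤ Bv)
    (hw : ∀ p : ℝ × ℝ, p.1 ∈ Ioo (-r) r → w (levelChart μ K p) = v p.2) :
    ∫ q in {q : ℝ × ℝ | |q.1| < π ∧ |q.2| < π ∧ |frameLevel μ K (WithLp.toLp 2 ![q.1, q.2])| < r}, w q * φ (frameLevel μ K (WithLp.toLp 2 ![q.1, q.2])) =
      ∫ ρ in Ioo (-r) r, (∫ ϑ in Ioc 0 (2 * π), levelChartJac μ K (ρ, ϑ) * v ϑ) * φ ρ := by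
  have hπ := Real.pi_pos
  rw [setIntegral_tube_eq_chart B hA hADt hlo hhi]
  have hbox : ∀ p ∈ Ioo (-r) r ×ˢ Ioc (-π) π,
      (perturbedFermiRadius (fun k : Fin 2 → ℝ => -K.eval k) (μ + p.1) p.2 *
          deriv (fun m : ℝ => perturbedFermiRadius (fun k : Fin 2 → ℝ => -K.eval k) m p.2) (μ + p.1)) •
        (w (levelChart μ K p) * φ (frameLevel μ K (WithLp.toLp 2 ![(levelChart μ K p).1, (levelChart μ K p).2]))) =
      levelChartJac μ K p * (v p.2 * φ p.1) := by
    intro p hp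
    have hp1 : p.1 ∈ Ioo (-r) r := (mem_prod.1 hp).1
    rw [smul_eq_mul, toLp_vec_levelChart, frameLevel_levelPoint B hA (by linarith [hp1.1]) (by linarith [hp1.2]), ← levelChartJac_apply, hw p hp1]
  rw [setIntegral_congr_fun (measurableSet_Ioo.prod measurableSet_Ioc) hbox]
  -- integrability of `J·(v∘snd·φ∘fst)` on every chart box
  have hKint : ∀ u u' : ℝ, IntegrableOn (fun p : ℝ × ℝ => levelChartJac μ K p * (v p.2 * φ p.1)) (Ioo (-r) r ×ˢ Ioc u u') := by
    intro u u'
    have hJ := integrableOn_levelChartJac_box B hA hADt hlo hhi (measurableSet_Ioo.prod measurableSet_Ioc) (subset_refl (Ioo (-r) r ×ˢ Ioc u u'))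
    refine Integrable.mul_of_top_left hJ ?_
    have hBv : 0 ≤ Bv := (abs_nonneg _).trans (hvb 0)
    exact memLp_top_of_bound ((hvm.comp measurable_snd).mul (hφm.comp measurable_fst)).aestronglyMeasurable (Bv * C)
      (Filter.Eventually.of_forall fun p => by
        rw [Real.norm_eq_abs, abs_mul]
        exact mul_le_mul (hvb p.2) (hφb p.1) (abs_nonneg _) hBv)
  -- shift the angular window and apply Fubini
  have hper : ∀ ρ, Function.Periodic (fun ϑ => levelChartJac μ K (ρ, ϑ) * (v (ρ, ϑ).2 * φ (ρ, ϑ).1)) (2 * π) := by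
    intro ρ ϑ; simp only [levelChartJac_periodic μ K ρ ϑ, hvp ϑ]
  rw [setIntegral_box_shift_angle hper (hKint _ _) (hKint _ _), Measure.volume_eq_prod, setIntegral_prod _ (by
    rw [← Measure.volume_eq_prod]; exact hKint _ _)]
  refine setIntegral_congr_fun measurableSet_Ioo fun ρ _ => ?_
  simp only
  rw [← integral_mul_const]
  exact integral_congr_ae (Filter.Eventually.of_forall fun ϑ => by ring)

/-! ## §3 THE WEIGHTED PLANAR ROTATION LEMMA -/

/-- **THE PARTICLE–HOLE ROTATION LEMMA WITH AN ANGULAR WEIGHT, PLANAR FORM.**  For a real slice weight `G` (`|G| ≤ M_G`, `ℓ`-Lipschitz, `G = 0` for `s ≤ r₁²` and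
`s ≥ r₂²`, `0 < r₁`, `0 < r₂ < r`), `0 < β`, a Matsubara cutoff `βr₂/(2π) + 1 ≤ M`, and a planar weight `w` that is radially constant in the C4a chart,
`w(levelChart(ρ,ϑ)) = v(ϑ)` with `v` measurable, `2π`-periodic, `|v| ≤ B_v`:
`|β⁻¹ Σ_i ∫_{tube} w(q)·G(ω_i² + e_K²)(e_K² − ω_i²)/(ω_i² + e_K²)² dq| ≤ B_v·(N₀max·(2r₂·(2r₂L⋆))·(r₂ + 2π/β)/β + β⁻¹·(r₂β/π + 1)·(2r₂)·(2π·jacR·r₂·(M_G/r₁²)))`,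
`N₀max = 2π·π√2/(Dt_min − 2A)`, `L⋆ = 2r₂²(ℓ/r₁⁴ + 2M_G/r₁⁶) + ℓ/r₁² + M_G/r₁⁴`, `jacR = 1/(Dt_min − 2A)² + π√2(2 + 4A)/(Dt_min − 2A)³` — the rotation null PER ANGLE.
[cite: BenfattoGiulianiMastropietro2006, §2.4–§2.5] -/
theorem klpw_planar_rotation_weighted_le {M : ℕ} {β : ℝ} (hβ : 0 < β) {G : ℝ → ℝ} {Mg ℓ r₁ r₂ : ℝ} (hbd : ∀ s, |G s| ≤ Mg)
    (hlip : ∀ s s', |G s - G s'| ≤ ℓ * |s - s'|) (hin : ∀ s, s ≤ r₁ ^ 2 → G s = 0) (hout : ∀ s, r₂ ^ 2 ≤ s → G s = 0)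
    (hr₁ : 0 < r₁) (hr₂ : 0 < r₂) (hr₂r : r₂ < r) (hM : β * r₂ / (2 * Real.pi) + 1 ≤ M)
    (w : ℝ × ℝ → ℝ) (v : ℝ → ℝ) (hvm : Measurable v) (hvp : Function.Periodic v (2 * π)) {Bv : ℝ} (hvb : ∀ ϑ, |v ϑ| ≤ Bv)
    (hw : ∀ p : ℝ × ℝ, p.1 ∈ Ioo (-r) r → w (levelChart μ K p) = v p.2) :
    |β⁻¹ * ∑ i : MatsubaraIdx M, ∫ q in {q : ℝ × ℝ | |q.1| < π ∧ |q.2| < π ∧ |frameLevel μ K (WithLp.toLp 2 ![q.1, q.2])| < r},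
        w q * (G (matsubaraFreq β M i ^ 2 + frameLevel μ K (WithLp.toLp 2 ![q.1, q.2]) ^ 2) *
          (frameLevel μ K (WithLp.toLp 2 ![q.1, q.2]) ^ 2 - matsubaraFreq β M i ^ 2) /
            (matsubaraFreq β M i ^ 2 + frameLevel μ K (WithLp.toLp 2 ![q.1, q.2]) ^ 2) ^ 2)| ≤
      Bv * (2 * π * (π * Real.sqrt 2 / (B.Dtmin - 2 * A)) *
          ((2 * r₂ * (2 * r₂ * (2 * r₂ ^ 2 * (ℓ / r₁ ^ 4 + 2 * Mg / r₁ ^ 6) + (ℓ / r₁ ^ 2 + Mg / r₁ ^ 4)))) * (r₂ + 2 * Real.pi / β) / β) +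
        β⁻¹ * ((r₂ * β / π + 1) * (2 * r₂ * (2 * π * (1 / (B.Dtmin - 2 * A) ^ 2 + Real.pi * Real.sqrt 2 * (2 + 4 * A) / (B.Dtmin - 2 * A) ^ 3) * r₂ *
          (Mg / r₁ ^ 2))))) := by
  have hπ := Real.pi_pos
  have hr0 : 0 < r := hr₂.trans hr₂r
  have hMg : 0 ≤ Mg := (abs_nonneg _).trans (hbd 0)
  have hBv : 0 ≤ Bv := (abs_nonneg _).trans (hvb 0)
  have hℓ : 0 ≤ ℓ := by
    have h := hlip 0 1; have h0 : 0 ≤ |G 0 - G 1| := abs_nonneg _; norm_num at h; linarith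
  -- abbreviations: the integrand, the weighted level density, the Lipschitz constant
  obtain ⟨f, hf⟩ : ∃ f : ℝ → ℝ → ℝ, ∀ ω e, f ω e = G (ω ^ 2 + e ^ 2) * (e ^ 2 - ω ^ 2) / (ω ^ 2 + e ^ 2) ^ 2 := ⟨_, fun _ _ => rfl⟩
  obtain ⟨N, hN⟩ : ∃ N : ℝ → ℝ, ∀ ρ, N ρ = ∫ ϑ in Ioc 0 (2 * π), levelChartJac μ K (ρ, ϑ) * v ϑ := ⟨_, fun _ => rfl⟩
  set Ls : ℝ := 2 * r₂ ^ 2 * (ℓ / r₁ ^ 4 + 2 * Mg / r₁ ^ 6) + (ℓ / r₁ ^ 2 + Mg / r₁ ^ 4) with hLs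
  set jacR : ℝ := 1 / (B.Dtmin - 2 * A) ^ 2 + Real.pi * Real.sqrt 2 * (2 + 4 * A) / (B.Dtmin - 2 * A) ^ 3 with hjacR
  set N₀ : ℝ := 2 * π * (π * Real.sqrt 2 / (B.Dtmin - 2 * A)) with hN₀
  have hLs0 : 0 ≤ Ls := by positivity
  have hjac0 : 0 < jacR := by
    rw [hjacR]; exact jacRadialConst_pos B hADt (le_trans (norm_nonneg _) (hA 0 0 (by norm_num)))
  have hd : 0 < B.Dtmin - 2 * A := by linarith
  have hN₀0 : 0 ≤ N₀ := by positivity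
  -- facts about `f`
  have hfb : ∀ ω e, |f ω e| ≤ Mg / r₁ ^ 2 := fun ω e => by rw [hf]; exact klph_f_abs_le hbd hin hr₁ ω e
  have hfω0 : ∀ ω, r₂ ≤ |ω| → ∀ e, f ω e = 0 := fun ω hω e => by rw [hf]; exact klph_f_zero_of_freq hout hr₂.le hω e
  have hfe0 : ∀ ω e, r₂ ≤ |e| → f ω e = 0 := fun ω e he => by rw [hf]; exact klph_f_zero_of_level hout hr₂.le ω he
  have hflip : ∀ e ω ω', |f ω e - f ω' e| ≤ 2 * r₂ * Ls * |ω - ω'| := by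
    intro e ω ω'
    rcases le_or_gt (|e|) r₂ with he | he
    · rw [hf, hf]; exact klph_f_lipschitz_freq hbd hlip hin hout hr₁ hr₂.le he ω ω'
    · rw [hfe0 ω e he.le, hfe0 ω' e he.le, sub_zero, abs_zero]; positivity
  have hfcont : Continuous fun p : ℝ × ℝ => f p.1 p.2 := by
    have := klph_f_continuous hbd hlip hin hr₁; refine this.congr fun p => ?_; simp only [hf]
  have hfint : Integrable fun p : ℝ × ℝ => f p.1 p.2 := by
    have := klph_f_integrable hbd hlip hin hout hr₁ hr₂.le; refine this.congr (Filter.Eventually.of_forall fun p => ?_); simp only [hf]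
  have hfibre : ∀ ω, Integrable fun e => f ω e := fun ω => by
    refine (hfcont.comp (continuous_const.prodMk continuous_id)).integrable_of_hasCompactSupport ?_
    exact HasCompactSupport.intro (isCompact_Icc (a := -r₂) (b := r₂)) fun e he => hfe0 ω e (klsp_le_abs_of_not_mem_Icc he)
  have hfmeas : ∀ ω, Measurable fun e => f ω e := fun ω => (hfcont.comp (continuous_const.prodMk continuous_id)).measurable
  -- the frequency function `F(ω) = ∫ f(ω,ρ) dρ`
  have hFeq : ∀ ω, ∫ ρ in Ioo (-r) r, f ω ρ = ∫ ρ, f ω ρ := fun ω =>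
    setIntegral_eq_integral_of_forall_compl_eq_zero fun ρ hρ => hfe0 ω ρ (by
      by_contra h; exact hρ ⟨by linarith [(abs_lt.1 (not_le.1 h)).1], by linarith [(abs_lt.1 (not_le.1 h)).2]⟩)
  have hF0 : ∀ ω, r₂ ≤ |ω| → ∫ ρ, f ω ρ = 0 := fun ω hω => by simp only [hfω0 ω hω, integral_zero]
  have hFlip : ∀ ω ω', ‖(∫ ρ, f ω ρ) - ∫ ρ, f ω' ρ‖ ≤ 2 * r₂ * (2 * r₂ * Ls) * |ω - ω'| := by
    intro ω ω'
    rw [← integral_sub (hfibre ω) (hfibre ω'), Real.norm_eq_abs,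
      ← setIntegral_eq_integral_of_forall_compl_eq_zero (s := Icc (-r₂) r₂) (fun ρ hρ => by
        rw [hfe0 ω ρ (klsp_le_abs_of_not_mem_Icc hρ), hfe0 ω' ρ (klsp_le_abs_of_not_mem_Icc hρ), sub_zero])]
    have hvol : volume (Icc (-r₂) r₂) < ⊤ := by rw [Real.volume_Icc]; exact ENNReal.ofReal_lt_top
    have h := norm_setIntegral_le_of_norm_le_const hvol (f := fun ρ => f ω ρ - f ω' ρ) (C := 2 * r₂ * Ls * |ω - ω'|)
      (fun ρ _ => by rw [Real.norm_eq_abs]; exact hflip ρ ω ω')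
    rw [Real.norm_eq_abs, Real.volume_real_Icc_of_le (by linarith)] at h
    calc _ ≤ 2 * r₂ * Ls * |ω - ω'| * (r₂ - -r₂) := h
      _ = 2 * r₂ * (2 * r₂ * Ls) * |ω - ω'| := by ring
  have hFint : ∫ ω, ∫ ρ, f ω ρ = 0 := by
    rw [← integral_prod _ hfint]
    have := klph_integral_plane_eq_zero G
    rw [← this]
    exact integral_congr_ae (Filter.Eventually.of_forall fun p => by simp only [hf])
  -- the Matsubara midpoint rule on `F`
  have hRiem := klmr_matsubara_sum_sub_integral_norm_le (E := ℝ) (g := fun ω => ∫ ρ, f ω ρ) (D := 2 * r₂ * (2 * r₂ * Ls)) (by positivity)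
    hFlip hr₂.le hF0 hβ hM
  rw [hFint, smul_zero, sub_zero, smul_eq_mul, Real.norm_eq_abs] at hRiem
  -- per frequency: chart coordinates (weighted) and the DOS split
  have hchart : ∀ i : MatsubaraIdx M,
      ∫ q in {q : ℝ × ℝ | |q.1| < π ∧ |q.2| < π ∧ |frameLevel μ K (WithLp.toLp 2 ![q.1, q.2])| < r},
        w q * f (matsubaraFreq β M i) (frameLevel μ K (WithLp.toLp 2 ![q.1, q.2])) =
      N 0 * (∫ ρ, f (matsubaraFreq β M i) ρ) + ∫ ρ in Ioo (-r) r, (N ρ - N 0) * f (matsubaraFreq β M i) ρ := by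
    intro i
    rw [klpw_integral_tube_weighted_eq B hA hADt hlo hhi (f (matsubaraFreq β M i)) (hfmeas _) (hfb _) w v hvm hvp hvb hw, ← hFeq,
      ← integral_const_mul]
    simp_rw [← hN]
    rw [← integral_add]
    · exact setIntegral_congr_fun measurableSet_Ioo fun ρ _ => by ring
    · exact ((hfibre _).const_mul _).integrableOn
    · -- `(N_v − N_v 0)·f` is bounded and measurable on the finite interval
      have hNc : ContinuousOn (fun ρ => (N ρ - N 0) * f (matsubaraFreq β M i) ρ) (Ioo (-r) r) := by
        have hc := klpw_continuousOn_weightedDensity B hA hADt hlo hhi hvm hvb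
        refine ((hc.congr fun ρ _ => (hN ρ)).sub continuousOn_const).mul ?_
        exact (hfcont.comp (continuous_const.prodMk continuous_id)).continuousOn
      refine IntegrableOn.of_bound (by rw [Real.volume_Ioo]; exact ENNReal.ofReal_lt_top) (hNc.aestronglyMeasurable measurableSet_Ioo)
        ((2 * (Bv * N₀)) * (Mg / r₁ ^ 2)) (ae_restrict_of_forall_mem measurableSet_Ioo fun ρ hρ => ?_)
      have h1 := klpw_abs_weightedDensity_le B hA hADt hlo hhi hvb hρ
      have h0 := klpw_abs_weightedDensity_le B hA hADt hlo hhi hvb (ρ := 0) ⟨by linarith, hr0⟩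
      rw [← hN] at h1 h0
      rw [Real.norm_eq_abs, abs_mul]
      refine mul_le_mul ?_ (hfb _ _) (abs_nonneg _) (by positivity)
      calc |N ρ - N 0| ≤ |N ρ| + |N 0| := abs_sub _ _
        _ ≤ Bv * N₀ + Bv * N₀ := add_le_add h1 h0
        _ = 2 * (Bv * N₀) := by ring
  -- the DOS-slope term per frequency
  have hslope : ∀ i : MatsubaraIdx M, |∫ ρ in Ioo (-r) r, (N ρ - N 0) * f (matsubaraFreq β M i) ρ| ≤ 2 * r₂ * (Bv * (2 * π * jacR * r₂) * (Mg / r₁ ^ 2)) := by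
    intro i
    rw [setIntegral_eq_of_subset_of_forall_sdiff_eq_zero measurableSet_Ioo (Icc_subset_Ioo (by linarith) (by linarith) : Icc (-r₂) r₂ ⊆ Ioo (-r) r)
      (fun ρ hρ => by rw [hfe0 _ ρ (klsp_le_abs_of_not_mem_Icc hρ.2), mul_zero])]
    have hvol : volume (Icc (-r₂) r₂) < ⊤ := by rw [Real.volume_Icc]; exact ENNReal.ofReal_lt_top
    have h := norm_setIntegral_le_of_norm_le_const hvol (f := fun ρ => (N ρ - N 0) * f (matsubaraFreq β M i) ρ)
      (C := Bv * (2 * π * jacR * r₂) * (Mg / r₁ ^ 2)) (fun ρ hρ => by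
        have hρr : ρ ∈ Ioo (-r) r := ⟨by linarith [hρ.1], by linarith [hρ.2]⟩
        have hd := klpw_abs_weightedDensity_sub_le B hA hADt hlo hhi hvm hvb hρr (ρ' := 0) ⟨by linarith, hr0⟩
        rw [← hN, ← hN, sub_zero] at hd
        rw [Real.norm_eq_abs, abs_mul]
        refine mul_le_mul (hd.trans ?_) (hfb _ _) (abs_nonneg _) (by positivity)
        have : |ρ| ≤ r₂ := abs_le.2 ⟨hρ.1, hρ.2⟩
        have hj : 0 ≤ Bv * (2 * π * jacR) := by positivity
        calc Bv * (2 * π * (jacR * |ρ|)) = Bv * (2 * π * jacR) * |ρ| := by ring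
          _ ≤ Bv * (2 * π * jacR) * r₂ := mul_le_mul_of_nonneg_left this hj
          _ = Bv * (2 * π * jacR * r₂) := by ring)
    rw [Real.norm_eq_abs, Real.volume_real_Icc_of_le (by linarith)] at h
    calc _ ≤ Bv * (2 * π * jacR * r₂) * (Mg / r₁ ^ 2) * (r₂ - -r₂) := h
      _ = _ := by ring
  -- only frequencies `ω_i² < r₂²` contribute to the slope sum
  have hslope0 : ∀ i : MatsubaraIdx M, ¬ matsubaraFreq β M i ^ 2 < r₂ ^ 2 → ∫ ρ in Ioo (-r) r, (N ρ - N 0) * f (matsubaraFreq β M i) ρ = 0 := by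
    intro i hi
    have hω : r₂ ≤ |matsubaraFreq β M i| := by
      have h := sq_le_sq.1 (not_lt.1 hi); rwa [abs_of_pos hr₂] at h
    simp only [hfω0 _ hω, mul_zero, integral_zero]
  have hsum_slope : |∑ i : MatsubaraIdx M, ∫ ρ in Ioo (-r) r, (N ρ - N 0) * f (matsubaraFreq β M i) ρ| ≤
      (r₂ * β / π + 1) * (2 * r₂ * (Bv * (2 * π * jacR * r₂) * (Mg / r₁ ^ 2))) := by
    rw [← sum_filter_of_ne (p := fun i => matsubaraFreq β M i ^ 2 < r₂ ^ 2) (fun i _ hne => by by_contra h; exact hne (hslope0 i h))]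
    refine (abs_sum_le_sum_abs _ _).trans ((sum_le_sum fun i _ => hslope i).trans ?_)
    rw [sum_const, nsmul_eq_mul]
    exact mul_le_mul_of_nonneg_right (klok_card_freq_le hβ hr₂.le) (by positivity)
  -- assemble
  have hN0 := klpw_abs_weightedDensity_le B hA hADt hlo hhi hvb (ρ := 0) ⟨by linarith, hr0⟩
  rw [← hN] at hN0
  have hmain : β⁻¹ * ∑ i : MatsubaraIdx M, ∫ q in {q : ℝ × ℝ | |q.1| < π ∧ |q.2| < π ∧ |frameLevel μ K (WithLp.toLp 2 ![q.1, q.2])| < r},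
        w q * f (matsubaraFreq β M i) (frameLevel μ K (WithLp.toLp 2 ![q.1, q.2])) =
      N 0 * (β⁻¹ * ∑ i : MatsubaraIdx M, ∫ ρ, f (matsubaraFreq β M i) ρ) +
        β⁻¹ * ∑ i : MatsubaraIdx M, ∫ ρ in Ioo (-r) r, (N ρ - N 0) * f (matsubaraFreq β M i) ρ := by
    rw [Finset.sum_congr rfl fun i _ => hchart i, sum_add_distrib, ← mul_sum]; ring
  have hgoal : |β⁻¹ * ∑ i : MatsubaraIdx M, ∫ q in {q : ℝ × ℝ | |q.1| < π ∧ |q.2| < π ∧ |frameLevel μ K (WithLp.toLp 2 ![q.1, q.2])| < r},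
        w q * f (matsubaraFreq β M i) (frameLevel μ K (WithLp.toLp 2 ![q.1, q.2]))| ≤
      Bv * N₀ * ((2 * r₂ * (2 * r₂ * Ls)) * (r₂ + 2 * Real.pi / β) / β) +
        β⁻¹ * ((r₂ * β / π + 1) * (2 * r₂ * (Bv * (2 * π * jacR * r₂) * (Mg / r₁ ^ 2)))) := by
    rw [hmain]
    refine (abs_add_le _ _).trans (add_le_add ?_ ?_)
    · rw [abs_mul]
      exact mul_le_mul hN0 hRiem (abs_nonneg _) (by positivity)
    · rw [abs_mul, abs_of_pos (inv_pos.2 hβ)]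
      exact mul_le_mul_of_nonneg_left hsum_slope (inv_pos.2 hβ).le
  have hfinal : Bv * N₀ * ((2 * r₂ * (2 * r₂ * Ls)) * (r₂ + 2 * Real.pi / β) / β) +
        β⁻¹ * ((r₂ * β / π + 1) * (2 * r₂ * (Bv * (2 * π * jacR * r₂) * (Mg / r₁ ^ 2)))) =
      Bv * (N₀ * ((2 * r₂ * (2 * r₂ * Ls)) * (r₂ + 2 * Real.pi / β) / β) +
        β⁻¹ * ((r₂ * β / π + 1) * (2 * r₂ * (2 * π * jacR * r₂ * (Mg / r₁ ^ 2))))) := by ring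
  have hrw : ∀ i : MatsubaraIdx M, ∀ q : ℝ × ℝ,
      w q * (G (matsubaraFreq β M i ^ 2 + frameLevel μ K (WithLp.toLp 2 ![q.1, q.2]) ^ 2) *
          (frameLevel μ K (WithLp.toLp 2 ![q.1, q.2]) ^ 2 - matsubaraFreq β M i ^ 2) /
            (matsubaraFreq β M i ^ 2 + frameLevel μ K (WithLp.toLp 2 ![q.1, q.2]) ^ 2) ^ 2) =
        w q * f (matsubaraFreq β M i) (frameLevel μ K (WithLp.toLp 2 ![q.1, q.2])) := fun i q => by rw [hf]
  simp_rw [hrw]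
  rw [hfinal] at hgoal
  exact hgoal

end Chart

end Summit.HubbardSuperconductivity.HubbardSuperconductivity.Theorems.KLRegimeSplit

end
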